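import Summits.HodgeConjecture.HodgeConjecture.Theorems.K2E3UnitaryLayerCharacterSurjective      -- ★ p856060 (this seat): (S-U) `exists_character_extension`, 𝔰_ε-projections; brings ★ (Char-U) p855984, ★ (S) GL p855619
import Summits.HodgeConjecture.HodgeConjecture.Theorems.K2E3UnitaryLayerOccurrenceNilpotent      -- ★ p856020 (this seat): (N-U) transfer `forall_map_trace_eq_one_of_unitary_occurrence`; brings ★ (N) GL p855641
import HarnessLib

/-!
# Crux `H413` — K2-LIT E3 «EllipticInputs», U12-h engine (Char-U∕S-U∕N-U with CONDUCTOR DEFECT): the four `𝔰_ε`-bricks of the non-split transport — non-degeneracy, near-commutation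
# (`hint`), occurrence (`hocc`), layer-character surjectivity (`hS`) — for an additive character `ψ` that is trivial on `𝒪` and non-trivial only at level `−1 − c₀` (instead of `−1`):
# every output exponent shifts by `c₀`.  This is what makes the twisted local character cheap at DYADIC non-split places (`ψ_± := ψ₁(x ± σx)`, `c₀ := v_E(2)`), so the (Psi-twisted)
# input of ★ p855958∕p856036 `exists_levelTraceStable_U(_regime)` is elementary at every place

Cell `hodgecm-mathlib`, Track B «K2-LIT», crux item `stmt-HodgeConjecture-24833` (h413), line `K2_E3_EllipticInputs`, unit U12 «HC characters», socket U12-h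
`sig_K2E3CharLocConstNearRegular` (‹#9L›), depth-halving road, non-split transport; seat K2E1b-p08 (g2) (K2 bus 2026-09-04T00:2xZ); `--supports stmt-HodgeConjecture-24833 --as
helper`.  THEOREMS ONLY — no `def`, no named fact, no instance, no notation, no `sorry`.  Same letters and argument order as the exact bricks (★ `valBound_of_forall_unitary_layer`,
★ `valBound_conj_sub_of_agree_on_unitary_overlap`, ★ `exists_nilpotent_add_valBound_of_unitary_occurrence`, ★ `exists_eigen_param_of_unitary_character`) with `hψ'` replaced by
`hψ'c : ∃ x, v x ≤ |ϖ|^{−(c₀+1)} ∧ ψ x ≠ 1`; `c₀ = 0` recovers them.  HONEST LABEL: HC_CM is proved only modulo the 7 printed citations (2 remaining named inputs: hLiu418 =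
stmt-HodgeConjecture-24832, h413 = stmt-HodgeConjecture-24833) until rung 0 closes; count-neutral.

THE MATHEMATICS [HarishChandra1999, §17 Thm. 17.1; BushnellHenniart2006, §1.7 (level of a character, `ψ ↦ ψ(c·)`); Weyl1939, Ch. II §10].  (§1) If `ψ` is trivial on `𝒪` and
non-trivial on `ϖ^{−c₀−1}𝒪`, its exact conductor exponent `c := min{j : ψ ≢ 1 on ϖ^{−j−1}𝒪} ≤ c₀` exists (`exists_exact_conductor`), and `ψ′ := ψ((ϖ^c)⁻¹·)` (Mathlib
`AddChar.mulShift`) has conductor EXACTLY `𝒪` with `χ^{ψ}_X = χ^{ψ′}_{ϖ^c X}` (`mulShift_map_trace_smul`).  (§2) The Cayley-test induction of ★ (Char-U) and the transfer of ★ (N-U)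
never used exactness, only `ψ|_𝒪 ≡ 1` and the twist `hanti` — which are statements about `ψ`, while ★ GL non-degeneracy ∕ ★ GL (N) ∕ ★ GL (S) are applied to `ψ′` and the rescaled
parameter `ϖ^c X` (no `𝔰_ε`-membership is needed on the GL side).  Undoing the rescaling costs `|ϖ|^{−c} ≤ |ϖ|^{−c₀}` in every output: `v(X) ≤ |ϖ|^{−(m′+c₀)}`
(`valBound_of_forall_unitary_layer_defect`), `cH := d + c₀` (`valBound_conj_sub_of_agree_on_unitary_overlap_defect`), `E := d + c₀` (`exists_nilpotent_add_valBound_of_unitary_occurrence_defect`),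
regime `N + c₀ + d_S ≤ 2N′` (`exists_eigen_param_of_unitary_character_defect`, with the `𝔰_ε`-projection step factored as `map_trace_mul_eq_projection_of_mem`).

## References
* [HarishChandra1999] Harish-Chandra (DeBacker–Sally), *Admissible Invariant Distributions on Reductive p-adic Groups*, ULECT 16 (1999), §17 Thm. 17.1, §20 p. 84.
* [BushnellHenniart2006] C. J. Bushnell, G. Henniart, *The Local Langlands Conjecture for GL(2)*, Grundlehren 335 (2006), §1.7.
* [Weyl1939] H. Weyl, *The Classical Groups* (1939), Ch. II §10.
-/

set_option autoImplicit false
-- the mandated namespace repeats `HodgeConjecture.HodgeConjecture`, as in every `Theorems/*.lean` of this sub-problem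
set_option linter.dupNamespace false

noncomputable section

open scoped MatrixGroups Matrix
open ValuativeRel Literature.NumberTheory.Automorphic Literature.LinearAlgebra.Matrix

namespace Summit.HodgeConjecture.HodgeConjecture.Cruxes.H413.K2E3UnitaryLayerConductorDefect

variable {E : Type*} [Field E] [ValuativeRel E] {N : ℕ} (σ : E →+* E) {J : Matrix (Fin N) (Fin N) E} {ϖ : E} {M : Type*} [CommMonoid M] (ψ : AddChar E M)

/-! ## §1 Conductor normalisation `ψ ↦ ψ′ = ψ((ϖ^c)⁻¹ ·)` -/

omit σ in
/-- **THE EXACT CONDUCTOR EXPONENT**: `ψ` trivial on `𝒪` and non-trivial on `ϖ^{−c₀−1}𝒪` ⇒ `∃ c ≤ c₀`, `ψ ≡ 1` on `ϖ^{−c}𝒪` and `ψ ≢ 1` on `ϖ^{−c−1}𝒪` (least such `c`).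
[cite: BushnellHenniart2006, §1.7] -/
theorem exists_exact_conductor (hψ : ∀ x : E, valuation E x ≤ 1 → ψ x = 1) {c₀ : ℕ}
    (hψ'c : ∃ x : E, valuation E x ≤ (valuation E ϖ ^ (c₀ + 1))⁻¹ ∧ ψ x ≠ 1) :
    ∃ c : ℕ, c ≤ c₀ ∧ (∀ x : E, valuation E x ≤ (valuation E ϖ ^ c)⁻¹ → ψ x = 1) ∧ ∃ x : E, valuation E x ≤ (valuation E ϖ ^ (c + 1))⁻¹ ∧ ψ x ≠ 1 := by
  classical
  have hex : ∃ c : ℕ, ∃ x : E, valuation E x ≤ (valuation E ϖ ^ (c + 1))⁻¹ ∧ ψ x ≠ 1 := ⟨c₀, hψ'c⟩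
  refine ⟨Nat.find hex, Nat.find_min' hex hψ'c, fun x hx => ?_, Nat.find_spec hex⟩
  rcases Nat.eq_zero_or_eq_succ_pred (Nat.find hex) with h0 | hs
  · rw [h0, pow_zero, inv_one] at hx; exact hψ x hx
  · have hmin := Nat.find_min hex (show Nat.find hex - 1 < Nat.find hex by omega)
    push Not at hmin
    rw [hs, Nat.pred_eq_sub_one] at hx
    exact hmin x hx

omit σ in
/-- **`ψ′ := ψ((ϖ^c)⁻¹·)` HAS CONDUCTOR EXACTLY `𝒪`** when `c` is the exact conductor exponent of `ψ`. [cite: BushnellHenniart2006, §1.7] -/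
theorem mulShift_conductor (hϖ : IsUniformizingElement ϖ) {c : ℕ} (hψc : ∀ x : E, valuation E x ≤ (valuation E ϖ ^ c)⁻¹ → ψ x = 1)
    (hψc' : ∃ x : E, valuation E x ≤ (valuation E ϖ ^ (c + 1))⁻¹ ∧ ψ x ≠ 1) :
    (∀ x : E, valuation E x ≤ 1 → ψ.mulShift (ϖ ^ c)⁻¹ x = 1) ∧ ∃ x : E, valuation E x ≤ (valuation E ϖ)⁻¹ ∧ ψ.mulShift (ϖ ^ c)⁻¹ x ≠ 1 := by
  have hϖ0 : ϖ ≠ 0 := hϖ.ne_zero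
  have hπc : valuation E ϖ ^ c ≠ 0 := pow_ne_zero _ ((Valuation.ne_zero_iff _).2 hϖ0)
  refine ⟨fun x hx => ?_, ?_⟩
  · rw [AddChar.mulShift_apply]
    refine hψc _ ?_
    rw [map_mul, map_inv₀, map_pow]
    exact mul_le_of_le_one_right' hx
  · obtain ⟨x₀, hx₀, hne⟩ := hψc'
    refine ⟨ϖ ^ c * x₀, ?_, ?_⟩
    · rw [map_mul, map_pow]
      calc valuation E ϖ ^ c * valuation E x₀ ≤ valuation E ϖ ^ c * (valuation E ϖ ^ (c + 1))⁻¹ := mul_le_mul' le_rfl hx₀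
        _ = (valuation E ϖ)⁻¹ := by rw [pow_succ, mul_inv, ← mul_assoc, mul_inv_cancel₀ hπc, one_mul]
    · rwa [AddChar.mulShift_apply, inv_mul_cancel_left₀ (pow_ne_zero _ hϖ0)]

omit σ [ValuativeRel E] in
/-- **RESCALING**: `χ^{ψ′}_{ϖ^c X} = χ^{ψ}_X`, i.e. `ψ′(tr((ϖ^c•X)W)) = ψ(tr(XW))`. [cite: BushnellHenniart2006, §1.7] -/
theorem mulShift_map_trace_smul (hϖ0 : ϖ ≠ 0) (c : ℕ) (X W : Matrix (Fin N) (Fin N) E) :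
    ψ.mulShift (ϖ ^ c)⁻¹ (Matrix.trace ((ϖ ^ c • X) * W)) = ψ (Matrix.trace (X * W)) := by
  rw [AddChar.mulShift_apply, Matrix.smul_mul, Matrix.trace_smul, smul_eq_mul, inv_mul_cancel_left₀ (pow_ne_zero _ hϖ0)]

omit σ in
/-- Undoing the rescaling in a bound: `v(ϖ^c•X) ≤ |ϖ|^{−m}` ⇒ `v(X) ≤ |ϖ|^{−(m+c)}`. [folklore] -/
theorem valBound_of_valBound_smul_pow (hϖ : IsUniformizingElement ϖ) {c m : ℕ} {X : Matrix (Fin N) (Fin N) E} (h : ValBound (valuation E ϖ ^ m)⁻¹ (ϖ ^ c • X)) :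
    ValBound (valuation E ϖ ^ (m + c))⁻¹ X := by
  have hπ0 : 0 < valuation E ϖ := (Valuation.pos_iff _).2 hϖ.ne_zero
  intro i j
  have hij := h i j
  rw [Matrix.smul_apply, smul_eq_mul, map_mul, map_pow, mul_comm] at hij
  rw [pow_add, mul_inv, ← div_eq_mul_inv, le_div_iff₀ (pow_pos hπ0 _)]
  exact hij

omit σ in
/-- … and `v(B) ≤ |ϖ|^{−m}` ⇒ `v((ϖ^c)⁻¹•B) ≤ |ϖ|^{−(m+c)}`. [folklore] -/
theorem valBound_inv_pow_smul {c m : ℕ} {B : Matrix (Fin N) (Fin N) E} (h : ValBound (valuation E ϖ ^ m)⁻¹ B) :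
    ValBound (valuation E ϖ ^ (m + c))⁻¹ ((ϖ ^ c)⁻¹ • B) := by
  have h' := K2E3UnitaryLayerCharacters.valBound_smul (ϖ ^ c)⁻¹ h
  rw [map_inv₀, map_pow, ← mul_inv, ← pow_add, add_comm] at h'
  exact h'

omit σ in
/-- Monotonicity in the exponent: `v(X) ≤ |ϖ|^{−a}`, `a ≤ b` ⇒ `v(X) ≤ |ϖ|^{−b}`. [folklore] -/
theorem valBound_inv_pow_mono (hϖ : IsUniformizingElement ϖ) {a b : ℕ} (hab : a ≤ b) {X : Matrix (Fin N) (Fin N) E} (h : ValBound (valuation E ϖ ^ a)⁻¹ X) :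
    ValBound (valuation E ϖ ^ b)⁻¹ X :=
  h.mono (inv_anti₀ (pow_pos ((Valuation.pos_iff _).2 hϖ.ne_zero) _) (pow_le_pow_right_of_le_one' hϖ.valuation_le_one hab))

/-! ## §2 The four `𝔰_ε`-bricks with conductor defect `c₀` -/

section Bricks

variable [Invertible (2 : E)]

/-- **NON-DEGENERACY ON THE UNITARY LAYER, conductor defect `c₀`**: as ★ `valBound_of_forall_unitary_layer` with `hψ'c` at level `−1−c₀`; conclusion `v(X) ≤ |ϖ|^{−(m′+c₀)}`.
[cite: HarishChandra1999, §17 Thm. 17.1] [cite: Weyl1939, Ch. II §10] -/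
theorem valBound_of_forall_unitary_layer_defect (hϖ : IsUniformizingElement ϖ) (hψ : ∀ x : E, valuation E x ≤ 1 → ψ x = 1) {c₀ : ℕ}
    (hψ'c : ∃ x : E, valuation E x ≤ (valuation E ϖ ^ (c₀ + 1))⁻¹ ∧ ψ x ≠ 1) {ε : E} (hanti : ∀ a : E, σ a = ε * a → ψ a = 1)
    (hσ : ∀ a : E, σ (σ a) = a) (hσv : ∀ a : E, valuation E (σ a) = valuation E a) (hJ : (J.map σ)ᵀ = J) (hJu : IsUnit J.det)
    {κ κ' : ValueGroupWithZero E} (hJb : ValBound κ J) (hJib : ValBound κ' J⁻¹) {d : ℕ}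
    (hd : valuation E (⅟(2 : E)) * (valuation E (⅟(2 : E)) * max 1 (κ' * κ)) * valuation E ϖ ^ d ≤ 1)
    {X : Matrix (Fin N) (Fin N) E} (hXu : J⁻¹ * (X.map σ)ᵀ * J = ε • X) {L₀ : ℕ} (hXb : ValBound (valuation E ϖ ^ L₀)⁻¹ X) {m : ℕ}
    (htriv : ∀ k ∈ unitaryGroupOfForm σ J, k ∈ congruenceGL N (valuation E ϖ ^ m) → ψ (Matrix.trace (X * ((k : Matrix (Fin N) (Fin N) E) - 1))) = 1)
    {m' : ℕ} (hm' : max m (d + 1) + d ≤ m') : ValBound (valuation E ϖ ^ (m' + c₀))⁻¹ X := by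
  obtain ⟨c, hc, hψc, hψc'⟩ := exists_exact_conductor ψ hψ hψ'c
  obtain ⟨-, h2⟩ := mulShift_conductor ψ hϖ hψc hψc'
  have hm'1 : 1 ≤ m' := by have := le_max_right m (d + 1); omega
  have htriv' : ∀ k ∈ unitaryGroupOfForm σ J, k ∈ congruenceGL N (valuation E ϖ ^ m) → (1 : GL (Fin N) E)⁻¹ * k * 1 ∈ congruenceGL N (valuation E ϖ ^ m) →
      ψ (Matrix.trace (X * ((k : Matrix (Fin N) (Fin N) E) - 1))) = 1 := fun k hk hkm _ => htriv k hk hkm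
  have key : ∀ k ∈ congruenceGL N (valuation E ϖ ^ m'), ψ.mulShift (ϖ ^ c)⁻¹ (Matrix.trace ((ϖ ^ c • X) * ((k : Matrix (Fin N) (Fin N) E) - 1))) = 1 := by
    intro k hk
    rw [mulShift_map_trace_smul ψ hϖ.ne_zero]
    refine K2E3UnitaryLayerCharacters.map_trace_mul_eq_one_of_bilevel σ ψ hϖ hψ hanti hσ hσv hJ hJu hJb hJib hd hXu hXb (Subgroup.one_mem _) htriv' hm' hm' hk.2.1 ?_
    simpa only [inv_one, Units.val_one, Matrix.one_mul, Matrix.mul_one] using hk.2.1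
  exact valBound_inv_pow_mono hϖ (by omega)
    (valBound_of_valBound_smul_pow hϖ (K2E3CongruenceLayerCharactersGL.valBound_of_forall_map_trace_eq_one (ψ.mulShift (ϖ ^ c)⁻¹) hϖ h2 hm'1 key))

/-- **NEAR-COMMUTATION FROM AGREEMENT ON A UNITARY OVERLAP, conductor defect `c₀`** (brick hint-U): as ★ `valBound_conj_sub_of_agree_on_unitary_overlap`; conclusion
`v(yXy⁻¹ − X′) ≤ |ϖ|^{−(m′+c₀)}` for `m′ ≥ max(m+2h, d+1) + d` — so `cH := d + c₀` with floor `m₀ := d + 1`. [cite: HarishChandra1999, §17 p. 80, Thm. 17.1] -/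
theorem valBound_conj_sub_of_agree_on_unitary_overlap_defect {M' : Type*} [CommGroup M'] (ψ' : AddChar E M') (hϖ : IsUniformizingElement ϖ)
    (hψ : ∀ x : E, valuation E x ≤ 1 → ψ' x = 1) {c₀ : ℕ} (hψ'c : ∃ x : E, valuation E x ≤ (valuation E ϖ ^ (c₀ + 1))⁻¹ ∧ ψ' x ≠ 1) {ε : E}
    (hanti : ∀ a : E, σ a = ε * a → ψ' a = 1) (hσ : ∀ a : E, σ (σ a) = a) (hσv : ∀ a : E, valuation E (σ a) = valuation E a) (hJ : (J.map σ)ᵀ = J)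
    (hJu : IsUnit J.det) {κ κ' : ValueGroupWithZero E} (hJb : ValBound κ J) (hJib : ValBound κ' J⁻¹) {d : ℕ}
    (hd : valuation E (⅟(2 : E)) * (valuation E (⅟(2 : E)) * max 1 (κ' * κ)) * valuation E ϖ ^ d ≤ 1)
    {X X' : Matrix (Fin N) (Fin N) E} (hXu : J⁻¹ * (X.map σ)ᵀ * J = ε • X) (hX'u : J⁻¹ * (X'.map σ)ᵀ * J = ε • X') {L₀ : ℕ}
    (hXb : ValBound (valuation E ϖ ^ L₀)⁻¹ X) (hX'b : ValBound (valuation E ϖ ^ L₀)⁻¹ X')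
    {y : GL (Fin N) E} (hy : y ∈ unitaryGroupOfForm σ J) {h : ℕ} (hyh : ValBound (valuation E ϖ ^ h)⁻¹ (y : Matrix (Fin N) (Fin N) E))
    (hyh' : ValBound (valuation E ϖ ^ h)⁻¹ ((y⁻¹ : GL (Fin N) E) : Matrix (Fin N) (Fin N) E)) {m : ℕ}
    (hagree : ∀ a ∈ unitaryGroupOfForm σ J, a ∈ congruenceGL N (valuation E ϖ ^ m) → y⁻¹ * a * y ∈ congruenceGL N (valuation E ϖ ^ m) →
      ψ' (Matrix.trace (X * (((y⁻¹ * a * y : GL (Fin N) E) : Matrix (Fin N) (Fin N) E) - 1))) = ψ' (Matrix.trace (X' * ((a : Matrix (Fin N) (Fin N) E) - 1))))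
    {m' : ℕ} (hm' : max (m + 2 * h) (d + 1) + d ≤ m') :
    ValBound (valuation E ϖ ^ (m' + c₀))⁻¹ ((y : Matrix (Fin N) (Fin N) E) * X * ((y⁻¹ : GL (Fin N) E) : Matrix (Fin N) (Fin N) E) - X') := by
  have hπ0 : 0 < valuation E ϖ := (Valuation.pos_iff _).2 hϖ.ne_zero
  have hDu : J⁻¹ * (((y : Matrix (Fin N) (Fin N) E) * X * ((y⁻¹ : GL (Fin N) E) : Matrix (Fin N) (Fin N) E) - X').map σ)ᵀ * J =
      ε • ((y : Matrix (Fin N) (Fin N) E) * X * ((y⁻¹ : GL (Fin N) E) : Matrix (Fin N) (Fin N) E) - X') := by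
    rw [formAdjoint_sub σ, K2E3UnitaryLayerCharacters.formAdjoint_conj_eq_smul_of_mem σ hJu hy hXu, hX'u, smul_sub]
  have hDb : ValBound (valuation E ϖ ^ (L₀ + 2 * h))⁻¹ ((y : Matrix (Fin N) (Fin N) E) * X * ((y⁻¹ : GL (Fin N) E) : Matrix (Fin N) (Fin N) E) - X') := by
    refine ValBound.sub (((hyh.mul hXb).mul hyh').mono (le_of_eq ?_)) (hX'b.mono (inv_anti₀ (pow_pos hπ0 _) (pow_le_pow_right_of_le_one' hϖ.valuation_le_one (by omega))))
    rw [← mul_inv, ← mul_inv, ← pow_add, ← pow_add, show h + L₀ + h = L₀ + 2 * h by ring]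
  have htriv : ∀ k ∈ unitaryGroupOfForm σ J, k ∈ congruenceGL N (valuation E ϖ ^ (m + 2 * h)) →
      ψ' (Matrix.trace (((y : Matrix (Fin N) (Fin N) E) * X * ((y⁻¹ : GL (Fin N) E) : Matrix (Fin N) (Fin N) E) - X') * ((k : Matrix (Fin N) (Fin N) E) - 1))) = 1 := by
    intro k hk hkm
    obtain ⟨hk0, -, hk2⟩ := K2E3CongruenceLayerIntertwiningGL.mem_overlap_of_mem_congruenceGL_pow_add hϖ m h hyh hyh' hkm
    have e := hagree k hk hk0 hk2
    rw [show y⁻¹ * k * y = y⁻¹ * k * y⁻¹⁻¹ by rw [inv_inv], K2E3CongruenceLayerCharactersGL.map_trace_mul_coe_conj_sub_one, inv_inv] at e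
    rw [Matrix.sub_mul, Matrix.trace_sub, AddChar.map_sub_eq_div, e, div_self']
  exact valBound_of_forall_unitary_layer_defect σ ψ' hϖ hψ hψ'c hanti hσ hσv hJ hJu hJb hJib hd hDu hDb htriv hm'

/-- **OCCURRENCE ⇒ NILPOTENT + BOUNDED ON A UNITARY GROUP, conductor defect `c₀`** (brick hocc-U): as ★ `exists_nilpotent_add_valBound_of_unitary_occurrence`; conclusion
`X = Z + B`, `Z` nilpotent, `v(B) ≤ |ϖ|^{−(N′+d+c₀)}` — so `E := d + c₀` with floor `d + 1 ≤ ν′ ≤ N′`. [cite: HarishChandra1999, §20 p. 84] -/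
theorem exists_nilpotent_add_valBound_of_unitary_occurrence_defect [IsDiscreteValuationRing 𝒪[E]] (hϖ : IsUniformizingElement ϖ)
    (hψ : ∀ x : E, valuation E x ≤ 1 → ψ x = 1) {c₀ : ℕ} (hψ'c : ∃ z : E, valuation E z ≤ (valuation E ϖ ^ (c₀ + 1))⁻¹ ∧ ψ z ≠ 1) {ε : E}
    (hanti : ∀ a : E, σ a = ε * a → ψ a = 1) (hσ : ∀ a : E, σ (σ a) = a) (hσv : ∀ a : E, valuation E (σ a) = valuation E a) (hJ : (J.map σ)ᵀ = J)
    (hJu : IsUnit J.det) {κ κ' : ValueGroupWithZero E} (hJb : ValBound κ J) (hJib : ValBound κ' J⁻¹) {d : ℕ}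
    (hd : valuation E (⅟(2 : E)) * (valuation E (⅟(2 : E)) * max 1 (κ' * κ)) * valuation E ϖ ^ d ≤ 1)
    {X : Matrix (Fin N) (Fin N) E} (hXu : J⁻¹ * (X.map σ)ᵀ * J = ε • X) {L₀ : ℕ} (hXb : ValBound (valuation E ϖ ^ L₀)⁻¹ X)
    {x : GL (Fin N) E} (hx : x ∈ unitaryGroupOfForm σ J) {N' ν' : ℕ} (hν' : d + 1 ≤ ν') (hνN : ν' ≤ N')
    (hocc : ∀ k ∈ unitaryGroupOfForm σ J, k ∈ congruenceGL N (valuation E ϖ ^ N') → x⁻¹ * k * x ∈ congruenceGL N (valuation E ϖ ^ ν') →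
      ψ (Matrix.trace (X * ((k : Matrix (Fin N) (Fin N) E) - 1))) = 1) :
    ∃ Z B : Matrix (Fin N) (Fin N) E, IsNilpotent Z ∧ ValBound (valuation E ϖ ^ (N' + d + c₀))⁻¹ B ∧ X = Z + B := by
  have hϖ0 : ϖ ≠ 0 := hϖ.ne_zero
  obtain ⟨c, hc, hψc, hψc'⟩ := exists_exact_conductor ψ hψ hψ'c
  obtain ⟨-, h2⟩ := mulShift_conductor ψ hϖ hψc hψc'
  have htr := K2E3UnitaryLayerOccurrenceNilpotent.forall_map_trace_eq_one_of_unitary_occurrence σ ψ hϖ hψ hanti hσ hσv hJ hJu hJb hJib hd hXu hXb hx hν' hνN hocc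
  have htr' : ∀ k ∈ congruenceGL N (valuation E ϖ ^ (N' + d)), x⁻¹ * k * x ∈ congruenceGL N (valuation E ϖ ^ (ν' + d)) →
      ψ.mulShift (ϖ ^ c)⁻¹ (Matrix.trace ((ϖ ^ c • X) * ((k : Matrix (Fin N) (Fin N) E) - 1))) = 1 := fun k hk hkx => by
    rw [mulShift_map_trace_smul ψ hϖ0]; exact htr k hk hkx
  obtain ⟨Z, B, hZ, hB, hX⟩ := K2E3CongruenceLayerOccurrenceNilpotentGL.exists_nilpotent_add_valBound_of_occurrence (ψ.mulShift (ϖ ^ c)⁻¹) hϖ h2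
    (by omega) (by omega) x htr'
  refine ⟨(ϖ ^ c)⁻¹ • Z, (ϖ ^ c)⁻¹ • B, hZ.smul _, valBound_inv_pow_mono hϖ (by omega) (valBound_inv_pow_smul (c := c) hB), ?_⟩
  rw [← smul_add, ← hX, inv_smul_smul₀ (pow_ne_zero _ hϖ0)]

/-- **THE `𝔰_ε`-PROJECTION STEP (factored)**: `X₀` with `v(X₀) ≤ γ₀`, `a ∈ U(σ,J)` with `v(a − 1) ≤ γ`, and `(cμγ₀)·(cμγ²) ≤ 1` (`c = v(⅟2)`, `μ = max(1,κ′κ)`) ⇒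
`ψ(tr(X₀(a−1))) = ψ(tr(X(a−1)))` for `X := ½(X₀ + εθX₀)` (the complementary part is invisible on `(a−1)⁻` and integral against `(a−1)⁺ = −½θ(a−1)·(a−1)`).
[cite: HarishChandra1999, §17 Thm. 17.1] [cite: Weyl1939, Ch. II §10] -/
theorem map_trace_mul_eq_projection_of_mem (hψ : ∀ x : E, valuation E x ≤ 1 → ψ x = 1) {ε : E} (hε : ε = 1 ∨ ε = -1)
    (hanti : ∀ a : E, σ a = ε * a → ψ a = 1) (hσ : ∀ a : E, σ (σ a) = a) (hσv : ∀ a : E, valuation E (σ a) = valuation E a) (hJ : (J.map σ)ᵀ = J)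
    (hJu : IsUnit J.det) {κ κ' : ValueGroupWithZero E} (hJb : ValBound κ J) (hJib : ValBound κ' J⁻¹) {X₀ : Matrix (Fin N) (Fin N) E} {γ₀ : ValueGroupWithZero E}
    (hX₀ : ValBound γ₀ X₀) {a : GL (Fin N) E} (haU : a ∈ unitaryGroupOfForm σ J) {γ : ValueGroupWithZero E} (ha : ValBound γ ((a : Matrix (Fin N) (Fin N) E) - 1))
    (hreg : valuation E (⅟(2 : E)) * max 1 (κ' * κ) * γ₀ * (valuation E (⅟(2 : E)) * max 1 (κ' * κ) * (γ * γ)) ≤ 1) :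
    ψ (Matrix.trace (X₀ * ((a : Matrix (Fin N) (Fin N) E) - 1))) =
      ψ (Matrix.trace (⅟(2 : E) • (X₀ + ε • (J⁻¹ * (X₀.map σ)ᵀ * J)) * ((a : Matrix (Fin N) (Fin N) E) - 1))) := by
  obtain ⟨-, hXcb⟩ := K2E3UnitaryLayerCharacterSurjective.valBound_half_add_sub_eps σ hε hσv hJb hJib hX₀
  set W : Matrix (Fin N) (Fin N) E := (a : Matrix (Fin N) (Fin N) E) - 1 with hW
  have hXc := K2E3UnitaryLayerCharacterSurjective.formAdjoint_half_sub_eps_smul σ hε hσ hJ hJu X₀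
  have hsplit := K2E3UnitaryLayerInvolution.eq_half_sub_add_half_add W (J⁻¹ * (W.map σ)ᵀ * J)
  have hWm : J⁻¹ * ((⅟(2 : E) • (W - J⁻¹ * (W.map σ)ᵀ * J)).map σ)ᵀ * J = (-1 : E) • (⅟(2 : E) • (W - J⁻¹ * (W.map σ)ᵀ * J)) := by
    rw [neg_one_smul]; exact K2E3UnitaryLayerInvolution.formAdjoint_half_sub σ hσ hJ hJu W
  have hWpb := K2E3UnitaryLayerCharacterSurjective.valBound_half_add_formAdjoint_of_mem σ hσv hJu hJb hJib haU ha
  have hkill : ψ (Matrix.trace (⅟(2 : E) • (X₀ - ε • (J⁻¹ * (X₀.map σ)ᵀ * J)) * (⅟(2 : E) • (W - J⁻¹ * (W.map σ)ᵀ * J)))) = 1 :=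
    K2E3UnitaryLayerCharacterSurjective.map_trace_mul_eq_one_of_eigen₂ σ ψ hanti hJu (by rw [neg_mul_neg, mul_one]) hXc hWm
  have hint : ψ (Matrix.trace (⅟(2 : E) • (X₀ - ε • (J⁻¹ * (X₀.map σ)ᵀ * J)) * (⅟(2 : E) • (W + J⁻¹ * (W.map σ)ᵀ * J)))) = 1 :=
    K2E3CongruenceLayerCharactersGL.map_trace_mul_eq_one ψ hψ hreg hXcb hWpb
  conv_lhs => rw [K2E3UnitaryLayerCharacterSurjective.eq_half_add_add_half_sub X₀ (ε • (J⁻¹ * (X₀.map σ)ᵀ * J)), Matrix.add_mul, Matrix.trace_add,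
    AddChar.map_add_eq_mul]
  rw [show ψ (Matrix.trace (⅟(2 : E) • (X₀ - ε • (J⁻¹ * (X₀.map σ)ᵀ * J)) * W)) = 1 by
    conv_lhs => rw [hsplit]
    rw [Matrix.mul_add, Matrix.trace_add, AddChar.map_add_eq_mul, hkill, hint, one_mul], mul_one]

end Bricks

/-! ## §3 Layer-character surjectivity with conductor defect (non-archimedean local field) -/

section Surjective

variable [TopologicalSpace E] [IsNonarchimedeanLocalField E] [Invertible (2 : E)] {ψ₁ : AddChar E Circle}

/-- **EVERY CHARACTER OF A UNITARY LAYER IS `χ_X`, `X ∈ 𝔰_ε`, conductor defect `c₀`** (brick hS-U): as ★ `exists_eigen_param_of_unitary_character` with `hψ'c` at level `−1−c₀` and the regime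
`N + c₀ + d_S ≤ 2N′`; the bound becomes `v(X) ≤ v(⅟2)·max(1,κ′κ)·|ϖ|^{−(N+c₀)}`. [cite: HarishChandra1999, §17 Thm. 17.1] [cite: BushnellHenniart2006, §1.7] -/
theorem exists_eigen_param_of_unitary_character_defect (hϖ : IsUniformizingElement ϖ) (hψ : ∀ x : E, valuation E x ≤ 1 → ψ₁ x = 1) {c₀ : ℕ}
    (hψ'c : ∃ x : E, valuation E x ≤ (valuation E ϖ ^ (c₀ + 1))⁻¹ ∧ ψ₁ x ≠ 1) {ε : E} (hε : ε = 1 ∨ ε = -1) (hanti : ∀ a : E, σ a = ε * a → ψ₁ a = 1)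
    (hσ : ∀ a : E, σ (σ a) = a) (hσv : ∀ a : E, valuation E (σ a) = valuation E a) (hJ : (J.map σ)ᵀ = J) (hJu : IsUnit J.det)
    {κ κ' : ValueGroupWithZero E} (hJb : ValBound κ J) (hJib : ValBound κ' J⁻¹) {dS : ℕ}
    (hdS : valuation E (⅟(2 : E)) * max 1 (κ' * κ) * (valuation E (⅟(2 : E)) * max 1 (κ' * κ)) * valuation E ϖ ^ dS ≤ 1)
    {N' n : ℕ} (hN' : 1 ≤ N') (hle : N' ≤ n) (h2 : n + c₀ + dS ≤ 2 * N') (χ : GL (Fin N) E → Circle)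
    (hmul : ∀ a ∈ unitaryGroupOfForm σ J, a ∈ congruenceGL N (valuation E ϖ ^ N') → ∀ b ∈ unitaryGroupOfForm σ J, b ∈ congruenceGL N (valuation E ϖ ^ N') →
      χ (a * b) = χ a * χ b)
    (htriv : ∀ a ∈ unitaryGroupOfForm σ J, a ∈ congruenceGL N (valuation E ϖ ^ n) → χ a = 1) :
    ∃ X : Matrix (Fin N) (Fin N) E, J⁻¹ * (X.map σ)ᵀ * J = ε • X ∧ ValBound (valuation E (⅟(2 : E)) * max 1 (κ' * κ) * (valuation E ϖ ^ (n + c₀))⁻¹) X ∧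
      ∀ a ∈ unitaryGroupOfForm σ J, a ∈ congruenceGL N (valuation E ϖ ^ N') → χ a = ψ₁ (Matrix.trace (X * ((a : Matrix (Fin N) (Fin N) E) - 1))) := by
  have hπ1 := hϖ.valuation_le_one
  have hπ0 : 0 < valuation E ϖ := (Valuation.pos_iff _).2 hϖ.ne_zero
  have hϖ0 : ϖ ≠ 0 := hϖ.ne_zero
  obtain ⟨c, hc, hψc, hψc'⟩ := exists_exact_conductor ψ₁ hψ hψ'c
  obtain ⟨h1, h2'⟩ := mulShift_conductor ψ₁ hϖ hψc hψc'
  -- extend `χ` to a character `χ'` of `K_{N'}` trivial on `K_n`, then ★ (S) GL for the normalised character `ψ′`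
  obtain ⟨χ', hmul', htriv', hagree⟩ := K2E3UnitaryLayerCharacterSurjective.exists_character_extension (congruenceGL N (valuation E ϖ ^ N'))
    (congruenceGL N (valuation E ϖ ^ n)) (unitaryGroupOfForm σ J) (congruenceGL_mono (pow_le_pow_right_of_le_one' hπ1 hle))
    (fun a ha b hb => commutator_mem_congruenceGL_of_mul_le (by rw [← pow_add]; exact pow_le_pow_right_of_le_one' hπ1 (by omega)) ha hb) χ
    (fun a haU haK b hbU hbK => hmul a haU haK b hbU hbK) (fun a haU haK => htriv a haU haK)
  obtain ⟨Y₀, hY₀b, hY₀⟩ := K2E3CongruenceLayerCharacterSurjectiveGL.exists_valBound_and_forall_eq_map_trace hϖ h1 h2' hN' hle (by omega) χ' hmul' htriv'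
  -- undo the rescaling: `X₀ := (ϖ^c)⁻¹ • Y₀`
  set X₀ : Matrix (Fin N) (Fin N) E := (ϖ ^ c)⁻¹ • Y₀ with hX₀
  have hX₀b : ValBound (valuation E ϖ ^ (n + c₀))⁻¹ X₀ := valBound_inv_pow_mono hϖ (by omega) (valBound_inv_pow_smul (c := c) hY₀b)
  have hX₀χ : ∀ k ∈ congruenceGL N (valuation E ϖ ^ N'), χ' k = ψ₁ (Matrix.trace (X₀ * ((k : Matrix (Fin N) (Fin N) E) - 1))) := fun k hk => by
    rw [hY₀ k hk, ← mulShift_map_trace_smul ψ₁ hϖ0 c, hX₀, smul_inv_smul₀ (pow_ne_zero _ hϖ0)]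
  obtain ⟨hXb, -⟩ := K2E3UnitaryLayerCharacterSurjective.valBound_half_add_sub_eps σ hε hσv hJb hJib hX₀b
  refine ⟨⅟(2 : E) • (X₀ + ε • (J⁻¹ * (X₀.map σ)ᵀ * J)), K2E3UnitaryLayerCharacterSurjective.formAdjoint_half_add_eps_smul σ hε hσ hJ hJu X₀, hXb,
    fun a haU haK => ?_⟩
  rw [← hagree a haU haK, hX₀χ a haK]
  refine map_trace_mul_eq_projection_of_mem σ ψ₁ hψ hε hanti hσ hσv hJ hJu hJb hJib hX₀b haU haK.2.1 ?_
  have hreg : (valuation E ϖ ^ (n + c₀))⁻¹ * (valuation E ϖ ^ N' * valuation E ϖ ^ N') ≤ valuation E ϖ ^ dS := by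
    rw [← pow_add, inv_mul_le_iff₀ (pow_pos hπ0 _), ← pow_add]
    exact pow_le_pow_right_of_le_one' hπ1 (by omega)
  calc valuation E (⅟(2 : E)) * max 1 (κ' * κ) * (valuation E ϖ ^ (n + c₀))⁻¹ * (valuation E (⅟(2 : E)) * max 1 (κ' * κ) * (valuation E ϖ ^ N' * valuation E ϖ ^ N'))
        = valuation E (⅟(2 : E)) * max 1 (κ' * κ) * (valuation E (⅟(2 : E)) * max 1 (κ' * κ)) * ((valuation E ϖ ^ (n + c₀))⁻¹ * (valuation E ϖ ^ N' * valuation E ϖ ^ N')) := by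
          simp only [mul_assoc, mul_left_comm]
    _ ≤ valuation E (⅟(2 : E)) * max 1 (κ' * κ) * (valuation E (⅟(2 : E)) * max 1 (κ' * κ)) * valuation E ϖ ^ dS := mul_le_mul' le_rfl hreg
    _ ≤ 1 := hdS

end Surjective

end Summit.HodgeConjecture.HodgeConjecture.Cruxes.H413.K2E3UnitaryLayerConductorDefect

end
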